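/-
Copyright: the b2b-balaban T⁴-continuum CRUX team, row NE7b OWNER lineage `t4-ne7b-p1` (gen 144). Project licence.
-/
import Summits.QuantumFields.BalabanUV.T4Continuum.Spine.NE7b.SupFourthFormCovectorFDeriv

/-!
# THE ORDER-4 OBJECT `Q(ψ)` OF (533) IS FRÉCHET-DIFFERENTIABLE IN THE BACKGROUND, WITH DERIVATIVE `P(ψ₀)` (the `C⁵` repackaging, SCOPING-d16
# §B (B), second half; (533) one order up).  (533) proved `HasFDerivAt T Q(ψ) ψ` for the third form `T`, with
# `Q(ψ) = Σ_{x,y,z} (fderiv(T(·)[e_x,e_y,e_z])ψ)·b_{xyz}`, `b_{xyz} = proj_x ⊗ proj_y ⊗ proj_z` — the INPUT-format order-4 object of the next step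
# ((535) `hU₃d` with `U₃ := T`, `U₄ := Q`).  Here, THE END: `HasFDerivAt Q P(ψ₀) ψ₀` with
#   `P(ψ₀) = Σ_{x,y,z} (L ↦ L·b_{xyz}) ∘ (Σ_n (fderiv (ψ ↦ fderiv(T(·)[e_x,e_y,e_z])ψ[e_n]) ψ₀)·proj_n)`
# — (638) `hasFDerivAt_fderiv_third_form` for each basis triple, composed with the constant continuous linear map `L ↦ L.smulRight b_{xyz}`
# (`smulRightL`, flipped) and summed (`HasFDerivAt.fun_sum`³) — for `U ∈ C⁵` with bounded `U″…U⁽⁵⁾` under the regulator (row NE7b, node U5c;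
# (638) BY NAME; [folklore]).  This is the `hU₄d : HasFDerivAt U₄ (U₅ φ) φ` clause of the NEXT step's input with `U₄ := Q`, `U₅ := P`; the
# entries `P(ψ₀)[e_s][e_n][e_x,e_y,e_z] = fderiv(centred display[e_n;e_x,e_y,e_z])ψ₀[e_s]` ((532) at every `ψ`) are the `lineDeriv`s bounded by
# (600) `whitened_fifth_kernel_letter` (rows) and (610) `whitened_fifth_kernel_entry` (entries) — the packaging (535)′ is the next file.

Cell `pub-balaban`, sub-cell `t4`, spine estimate NE7b (`T4WeightBudget.RelWeightBound`; the cell's OWN estimate — NOT PRINTED in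
[Bałaban 1983–89], NOT PROVED).  Crux-route work under `Spine/NE7b/` by the row OWNER (`t4-ne7b-p1` gen 144, file (639)) under FREEZE
(0)'s crux-prover clause; NOTHING of Bałaban's is named as a Lean object, valued or asserted; no `T4Continuum/Support` leaf typed; no
`def`, no notation (`Q`, `P` WRITTEN OUT); zero `sorry`.  Imports (BY NAME): the OWNER's (638) `…SupFourthFormCovectorFDeriv`.

WHAT IS PROVED ([folklore]): THE END **`hasFDerivAt_fourth_form_clm`**; toy.

HONEST (what this is NOT).  The derivative is produced in composed form (`smulRightL`, `proj`); the ENTRY identities, the continuity of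
`P` in `ψ` (the input's `hU₅c`) and the order-5 packaging ((535)′: entry majorant, five letters, row and operator letters BY NAME) are NOT
here; `U ∈ C⁵` with bounded derivatives and the regulator are hypotheses; scalar skeleton ((A3), NC-NE7b-α UNRULED); nothing of Bałaban's
asserted.  BY-NAME EFFECT ON THE WALL: NONE.  NE7b NOT PRINTED ∕ NOT PROVED; spine PROVED 0∕9; rung (B)+1 — the programme's measures
remain FINITE-torus statements; NOT the mass gap, NOT Clay.  HONEST DEPENDENCY: continuum YM on T⁴ ⇐ BetaPertH ∧ nine spine estimates
(0∕9 proved); BetaPertH ⇐ (D1) ∧ (D4) ∧ CAP+tail; G-an2-4 gates asym, D1 and NE2∕3∕4.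
-/

set_option autoImplicit false
set_option maxSynthPendingDepth 4

noncomputable section

namespace Summit.QuantumFields.BalabanUV.T4Continuum.NE7b.SupFourthFormCLMFDeriv

open MeasureTheory ProbabilityTheory Finset Real Matrix
open scoped Topology
open SupFourthFormCovectorFDeriv (hasFDerivAt_fderiv_third_form)

variable {ι : Type} [Fintype ι] [DecidableEq ι]

section Main

variable {Γ : Matrix ι ι ℝ} {γop : ℝ} {U : EuclideanSpace ℝ ι → ℝ} {U' : EuclideanSpace ℝ ι → EuclideanSpace ℝ ι →L[ℝ] ℝ}
  {U'' : EuclideanSpace ℝ ι → EuclideanSpace ℝ ι →L[ℝ] EuclideanSpace ℝ ι →L[ℝ] ℝ}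
  {U₃ : EuclideanSpace ℝ ι → EuclideanSpace ℝ ι →L[ℝ] EuclideanSpace ℝ ι →L[ℝ] EuclideanSpace ℝ ι →L[ℝ] ℝ}
  {U₄ : EuclideanSpace ℝ ι → EuclideanSpace ℝ ι →L[ℝ] EuclideanSpace ℝ ι →L[ℝ] EuclideanSpace ℝ ι →L[ℝ]
    EuclideanSpace ℝ ι →L[ℝ] ℝ}
  {U₅ : EuclideanSpace ℝ ι → EuclideanSpace ℝ ι →L[ℝ] EuclideanSpace ℝ ι →L[ℝ] EuclideanSpace ℝ ι →L[ℝ]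
    EuclideanSpace ℝ ι →L[ℝ] EuclideanSpace ℝ ι →L[ℝ] ℝ}
  {κ₀ κ₁ a τ δ θ κ₂ κ₃ κ₄ κ₅ : ℝ}

set_option maxHeartbeats 4000000 in
/-- **THE END: `HasFDerivAt Q P(ψ₀) ψ₀`** — (533)'s order-4 object `Q`, as a function of the background, has the Fréchet derivative `P(ψ₀)`
(composed form) at every `ψ₀`, for `U ∈ C⁵` with bounded `U″…U⁽⁵⁾` under the regulator. [folklore] -/
theorem hasFDerivAt_fourth_form_clm (hΓ : Γ.PosSemidef) (hΓop : (γop • (1 : Matrix ι ι ℝ) - Γ).PosSemidef) (Y : Finset ι)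
    (hUd : ∀ φ : EuclideanSpace ℝ ι, HasFDerivAt U (U' φ) φ) (hU'd : ∀ φ : EuclideanSpace ℝ ι, HasFDerivAt U' (U'' φ) φ)
    (hU''d : ∀ φ : EuclideanSpace ℝ ι, HasFDerivAt U'' (U₃ φ) φ) (hU₃d : ∀ φ : EuclideanSpace ℝ ι, HasFDerivAt U₃ (U₄ φ) φ)
    (hU₄d : ∀ φ : EuclideanSpace ℝ ι, HasFDerivAt U₄ (U₅ φ) φ) (hU₅c : Continuous U₅) (hκ₀ : 0 ≤ κ₀) (hκ₁ : 0 ≤ κ₁) (ha : 0 ≤ a)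
    (hτ : 0 < τ) (hδ : 0 < δ) (hθ1 : θ < 1) (hκθ : (2 * κ₀ * (1 + τ) + 4 * δ) * γop ≤ θ)
    (hstab : ∀ φ : EuclideanSpace ℝ ι, -(κ₀ * ∑ x ∈ Y, φ x ^ 2) ≤ U φ) (hU'b : ∀ φ : EuclideanSpace ℝ ι, ‖U' φ‖ ≤ κ₁ * (a + ∑ x ∈ Y, φ x ^ 2))
    (hθ0 : 0 < θ) (hU''b : ∀ φ : EuclideanSpace ℝ ι, ‖U'' φ‖ ≤ κ₂) (hU₃b : ∀ φ : EuclideanSpace ℝ ι, ‖U₃ φ‖ ≤ κ₃)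
    (hU₄b : ∀ φ : EuclideanSpace ℝ ι, ‖U₄ φ‖ ≤ κ₄) (hU₅b : ∀ φ : EuclideanSpace ℝ ι, ‖U₅ φ‖ ≤ κ₅) (ψ₀ : EuclideanSpace ℝ ι) :
    HasFDerivAt (fun ψ : EuclideanSpace ℝ ι => ∑ x, ∑ y, ∑ z, (fderiv ℝ (fun ψ' : EuclideanSpace ℝ ι => ((∫ ω : EuclideanSpace ℝ ι, exp (-U (ω +
        ψ')) ∂(multivariateGaussian 0 Γ)))⁻¹ * (∫ ω : EuclideanSpace ℝ ι, exp (-U (ω + ψ')) * (U₃ (ω + ψ') (EuclideanSpace.single x (1 : ℝ))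
        (EuclideanSpace.single y (1 : ℝ)) (EuclideanSpace.single z (1 : ℝ)) - U' (ω + ψ') (EuclideanSpace.single y (1 : ℝ)) * U'' (ω + ψ')
        (EuclideanSpace.single x (1 : ℝ)) (EuclideanSpace.single z (1 : ℝ)) - U'' (ω + ψ') (EuclideanSpace.single x (1 : ℝ)) (EuclideanSpace.single
        y (1 : ℝ)) * U' (ω + ψ') (EuclideanSpace.single z (1 : ℝ)) - U' (ω + ψ') (EuclideanSpace.single x (1 : ℝ)) * U'' (ω + ψ')
        (EuclideanSpace.single y (1 : ℝ)) (EuclideanSpace.single z (1 : ℝ)) + U' (ω + ψ') (EuclideanSpace.single x (1 : ℝ)) * U' (ω + ψ')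
        (EuclideanSpace.single y (1 : ℝ)) * U' (ω + ψ') (EuclideanSpace.single z (1 : ℝ))) ∂(multivariateGaussian 0 Γ)) + ((∫ ω : EuclideanSpace ℝ
        ι, exp (-U (ω + ψ')) ∂(multivariateGaussian 0 Γ)) ^ 2)⁻¹ * (∫ ω : EuclideanSpace ℝ ι, exp (-U (ω + ψ')) * U' (ω + ψ') (EuclideanSpace.single
        x (1 : ℝ)) ∂(multivariateGaussian 0 Γ)) * (∫ ω : EuclideanSpace ℝ ι, exp (-U (ω + ψ')) * (U'' (ω + ψ') (EuclideanSpace.single y (1 : ℝ))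
        (EuclideanSpace.single z (1 : ℝ)) - U' (ω + ψ') (EuclideanSpace.single y (1 : ℝ)) * U' (ω + ψ') (EuclideanSpace.single z (1 : ℝ)))
        ∂(multivariateGaussian 0 Γ)) + ((∫ ω : EuclideanSpace ℝ ι, exp (-U (ω + ψ')) ∂(multivariateGaussian 0 Γ)) ^ 2)⁻¹ * (∫ ω : EuclideanSpace ℝ
        ι, exp (-U (ω + ψ')) * U' (ω + ψ') (EuclideanSpace.single y (1 : ℝ)) ∂(multivariateGaussian 0 Γ)) * (∫ ω : EuclideanSpace ℝ ι, exp (-U (ω +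
        ψ')) * (U'' (ω + ψ') (EuclideanSpace.single x (1 : ℝ)) (EuclideanSpace.single z (1 : ℝ)) - U' (ω + ψ') (EuclideanSpace.single x (1 : ℝ)) *
        U' (ω + ψ') (EuclideanSpace.single z (1 : ℝ))) ∂(multivariateGaussian 0 Γ)) + (((∫ ω : EuclideanSpace ℝ ι, exp (-U (ω + ψ'))
        ∂(multivariateGaussian 0 Γ)) ^ 2)⁻¹ * (∫ ω : EuclideanSpace ℝ ι, exp (-U (ω + ψ')) * (U'' (ω + ψ') (EuclideanSpace.single x (1 : ℝ))
        (EuclideanSpace.single y (1 : ℝ)) - U' (ω + ψ') (EuclideanSpace.single x (1 : ℝ)) * U' (ω + ψ') (EuclideanSpace.single y (1 : ℝ)))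
        ∂(multivariateGaussian 0 Γ)) + -2 / (∫ ω : EuclideanSpace ℝ ι, exp (-U (ω + ψ')) ∂(multivariateGaussian 0 Γ)) ^ 3 * -(∫ ω : EuclideanSpace ℝ
        ι, exp (-U (ω + ψ')) * U' (ω + ψ') (EuclideanSpace.single x (1 : ℝ)) ∂(multivariateGaussian 0 Γ)) * (∫ ω : EuclideanSpace ℝ ι, exp (-U (ω +
        ψ')) * U' (ω + ψ') (EuclideanSpace.single y (1 : ℝ)) ∂(multivariateGaussian 0 Γ))) * (∫ ω : EuclideanSpace ℝ ι, exp (-U (ω + ψ')) * U' (ω +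
        ψ') (EuclideanSpace.single z (1 : ℝ)) ∂(multivariateGaussian 0 Γ))) ψ).smulRight ((EuclideanSpace.proj x : EuclideanSpace ℝ ι →L[ℝ]
        ℝ).smulRight ((EuclideanSpace.proj y : EuclideanSpace ℝ ι →L[ℝ] ℝ).smulRight (EuclideanSpace.proj z : EuclideanSpace ℝ ι →L[ℝ] ℝ)))) (∑ x, ∑
        y, ∑ z, ((ContinuousLinearMap.smulRightL ℝ (EuclideanSpace ℝ ι) (EuclideanSpace ℝ ι →L[ℝ] EuclideanSpace ℝ ι →L[ℝ] EuclideanSpace ℝ ι →L[ℝ]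
        ℝ)).flip ((EuclideanSpace.proj x : EuclideanSpace ℝ ι →L[ℝ] ℝ).smulRight ((EuclideanSpace.proj y : EuclideanSpace ℝ ι →L[ℝ] ℝ).smulRight
        (EuclideanSpace.proj z : EuclideanSpace ℝ ι →L[ℝ] ℝ)))).comp (∑ n : ι, (fderiv ℝ (fun ψ : EuclideanSpace ℝ ι => (fderiv ℝ (fun ψ' :
        EuclideanSpace ℝ ι => ((∫ ω : EuclideanSpace ℝ ι, exp (-U (ω + ψ')) ∂(multivariateGaussian 0 Γ)))⁻¹ * (∫ ω : EuclideanSpace ℝ ι, exp (-U (ω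
        + ψ')) * (U₃ (ω + ψ') (EuclideanSpace.single x (1 : ℝ)) (EuclideanSpace.single y (1 : ℝ)) (EuclideanSpace.single z (1 : ℝ)) - U' (ω + ψ')
        (EuclideanSpace.single y (1 : ℝ)) * U'' (ω + ψ') (EuclideanSpace.single x (1 : ℝ)) (EuclideanSpace.single z (1 : ℝ)) - U'' (ω + ψ')
        (EuclideanSpace.single x (1 : ℝ)) (EuclideanSpace.single y (1 : ℝ)) * U' (ω + ψ') (EuclideanSpace.single z (1 : ℝ)) - U' (ω + ψ')
        (EuclideanSpace.single x (1 : ℝ)) * U'' (ω + ψ') (EuclideanSpace.single y (1 : ℝ)) (EuclideanSpace.single z (1 : ℝ)) + U' (ω + ψ')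
        (EuclideanSpace.single x (1 : ℝ)) * U' (ω + ψ') (EuclideanSpace.single y (1 : ℝ)) * U' (ω + ψ') (EuclideanSpace.single z (1 : ℝ)))
        ∂(multivariateGaussian 0 Γ)) + ((∫ ω : EuclideanSpace ℝ ι, exp (-U (ω + ψ')) ∂(multivariateGaussian 0 Γ)) ^ 2)⁻¹ * (∫ ω : EuclideanSpace ℝ
        ι, exp (-U (ω + ψ')) * U' (ω + ψ') (EuclideanSpace.single x (1 : ℝ)) ∂(multivariateGaussian 0 Γ)) * (∫ ω : EuclideanSpace ℝ ι, exp (-U (ω +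
        ψ')) * (U'' (ω + ψ') (EuclideanSpace.single y (1 : ℝ)) (EuclideanSpace.single z (1 : ℝ)) - U' (ω + ψ') (EuclideanSpace.single y (1 : ℝ)) *
        U' (ω + ψ') (EuclideanSpace.single z (1 : ℝ))) ∂(multivariateGaussian 0 Γ)) + ((∫ ω : EuclideanSpace ℝ ι, exp (-U (ω + ψ'))
        ∂(multivariateGaussian 0 Γ)) ^ 2)⁻¹ * (∫ ω : EuclideanSpace ℝ ι, exp (-U (ω + ψ')) * U' (ω + ψ') (EuclideanSpace.single y (1 : ℝ))
        ∂(multivariateGaussian 0 Γ)) * (∫ ω : EuclideanSpace ℝ ι, exp (-U (ω + ψ')) * (U'' (ω + ψ') (EuclideanSpace.single x (1 : ℝ))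
        (EuclideanSpace.single z (1 : ℝ)) - U' (ω + ψ') (EuclideanSpace.single x (1 : ℝ)) * U' (ω + ψ') (EuclideanSpace.single z (1 : ℝ)))
        ∂(multivariateGaussian 0 Γ)) + (((∫ ω : EuclideanSpace ℝ ι, exp (-U (ω + ψ')) ∂(multivariateGaussian 0 Γ)) ^ 2)⁻¹ * (∫ ω : EuclideanSpace ℝ
        ι, exp (-U (ω + ψ')) * (U'' (ω + ψ') (EuclideanSpace.single x (1 : ℝ)) (EuclideanSpace.single y (1 : ℝ)) - U' (ω + ψ')
        (EuclideanSpace.single x (1 : ℝ)) * U' (ω + ψ') (EuclideanSpace.single y (1 : ℝ))) ∂(multivariateGaussian 0 Γ)) + -2 / (∫ ω : EuclideanSpace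
        ℝ ι, exp (-U (ω + ψ')) ∂(multivariateGaussian 0 Γ)) ^ 3 * -(∫ ω : EuclideanSpace ℝ ι, exp (-U (ω + ψ')) * U' (ω + ψ') (EuclideanSpace.single
        x (1 : ℝ)) ∂(multivariateGaussian 0 Γ)) * (∫ ω : EuclideanSpace ℝ ι, exp (-U (ω + ψ')) * U' (ω + ψ') (EuclideanSpace.single y (1 : ℝ))
        ∂(multivariateGaussian 0 Γ))) * (∫ ω : EuclideanSpace ℝ ι, exp (-U (ω + ψ')) * U' (ω + ψ') (EuclideanSpace.single z (1 : ℝ))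
        ∂(multivariateGaussian 0 Γ))) ψ) (EuclideanSpace.single n (1 : ℝ))) ψ₀).smulRight (EuclideanSpace.proj n : EuclideanSpace ℝ ι →L[ℝ] ℝ))) ψ₀
        := by
  have hn1 : ∀ n : ι, ‖(EuclideanSpace.single n (1 : ℝ) : EuclideanSpace ℝ ι)‖ ≤ 1 := fun n => by
    simp
  refine HasFDerivAt.fun_sum fun x _ => HasFDerivAt.fun_sum fun y _ => HasFDerivAt.fun_sum fun z _ => ?_
  exact ((ContinuousLinearMap.smulRightL ℝ (EuclideanSpace ℝ ι) (EuclideanSpace ℝ ι →L[ℝ] EuclideanSpace ℝ ι →L[ℝ] EuclideanSpace ℝ ι →L[ℝ]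
      ℝ)).flip ((EuclideanSpace.proj x : EuclideanSpace ℝ ι →L[ℝ] ℝ).smulRight ((EuclideanSpace.proj y : EuclideanSpace ℝ ι →L[ℝ] ℝ).smulRight
      (EuclideanSpace.proj z : EuclideanSpace ℝ ι →L[ℝ] ℝ)))).hasFDerivAt.comp ψ₀
    (hasFDerivAt_fderiv_third_form hΓ hΓop Y hUd hU'd hU''d hU₃d hU₄d hU₅c hκ₀ hκ₁ ha hτ hδ hθ1 hκθ hstab hU'b hθ0 hU''b hU₃b hU₄b hU₅b ψ₀ (hn1 x)
      (hn1 y) (hn1 z))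

end Main

/-! ## Toy -/

/-- Toy (the composition step in one dimension): a constant linear map (multiplication by `c`) after a differentiable map. -/
example (f : ℝ → ℝ) (f' x c : ℝ) (hf : HasDerivAt f f' x) : HasDerivAt (fun y => c * f y) (c * f') x := hf.const_mul c

end Summit.QuantumFields.BalabanUV.T4Continuum.NE7b.SupFourthFormCLMFDeriv

end
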